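import Literature.AlgebraicGeometry.Resolution.ResolutionLocalization
import Literature.AlgebraicGeometry.Morphisms.IsoOverOpen
import HarnessLib

/-!
# `ProductDescent` (crux stmt-ResolutionOfSingularities-15231), line `birth` —
stub `stub_resolutionPullback`

Helper file (`--supports stmt-ResolutionOfSingularities-15231`; does not close the item).

RESOLUTIONS PULL BACK ALONG FLAT PREIMMERSIONS THROUGH THE GENERIC POINT: for `X` integral,
`ι : Z ⟶ X` flat and a preimmersion whose range contains the generic point of `X`, a weak
resolution `π : X' ⟶ X` (proper, birational, `X'` regular) base-changes to a weak resolution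
`X' ×_X Z ⟶ Z` of `Z`. This is the non-affine form of
`Literature.AlgebraicGeometry.Resolution.Scheme.HasResolution.of_isLocalization`
(`ResolutionLocalization.lean`, EGA IV₃ 8.10.5: resolutions localize), with the same proof:

* proper: base change;
* regular source: the projection `X' ×_X Z ⟶ X'` is flat and a preimmersion (base change), hence
  surjective on stalks, and regularity ascends along such maps
  (`Scheme.IsRegular.of_flat_of_surjectiveOnStalks`);
* birational: `π` is an isomorphism over a dense open `U` with dense preimage, so the base change
  is an isomorphism over `ι⁻¹U` (`Morphisms.isIso_morphismRestrict_pullback_snd`). Density: a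
  flat morphism is generalizing (`Flat.generalizingMap`) and a preimmersion is injective on points,
  so a point `z₀` of `Z` over the generic point of `X` specialises to every point of `Z`
  (`specializes_of_flat_of_injective`), whence every set containing `z₀` is dense; `ι z₀ ∈ U`
  because the generic point lies in every non-empty open. Upstairs, the point `q₀` of
  `X' ×_X Z` over `(ξ_{X'}, z₀)` (`π ξ_{X'} = ξ_X`, `apply_genericPoint_eq_of_isIso_morphismRestrict`)
  plays the same role for the flat preimmersion `X' ×_X Z ⟶ X'`.

Source: A. Grothendieck, *EGA* IV₃ (Publ. Math. IHÉS 28, 1966), 8.10.5. [EGAIV3]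
-/

set_option linter.dupNamespace false -- mandated namespace of this single-conjunct summit

noncomputable section

open CategoryTheory CategoryTheory.Limits AlgebraicGeometry Literature.AlgebraicGeometry.Resolution

namespace Summit.ResolutionOfSingularities.ResolutionOfSingularities.Theorems.ProductDescent.Birth

universe u

/-- **A point over the generic point of a flat, injective-on-points morphism is generic.** If
`φ : Z ⟶ X` is flat with `φ` injective on points, `X` is irreducible and `φ z₀` is the generic
point of `X`, then `z₀` specialises to every point of `Z`: generalizations lift along flat
morphisms (`Flat.generalizingMap`), so `ξ_X ⤳ φ z` lifts to some `z' ⤳ z` over `ξ_X`, and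
`z' = z₀` by injectivity. [folklore] -/
theorem specializes_of_flat_of_injective {Z X : Scheme.{u}} (φ : Z ⟶ X) [Flat φ]
    [IrreducibleSpace X] (hinj : Function.Injective φ.base) {z₀ : Z}
    (hz₀ : φ.base z₀ = genericPoint X) (z : Z) : z₀ ⤳ z := by
  obtain ⟨z', hz', hφz'⟩ := Flat.generalizingMap φ (genericPoint_specializes (φ.base z))
  obtain rfl : z' = z₀ := hinj (hφz'.trans hz₀.symm)
  exact hz'

/-- Along a flat, injective-on-points morphism `φ : Z ⟶ X` to an irreducible scheme, every set
containing a point `z₀` over the generic point of `X` is dense in `Z` (the closure of `{z₀}` is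
everything). [folklore] -/
theorem dense_of_mem_of_flat_of_injective {Z X : Scheme.{u}} (φ : Z ⟶ X) [Flat φ]
    [IrreducibleSpace X] (hinj : Function.Injective φ.base) {z₀ : Z}
    (hz₀ : φ.base z₀ = genericPoint X) {s : Set Z} (hs : z₀ ∈ s) : Dense s := by
  refine Dense.mono (Set.singleton_subset_iff.mpr hs) ?_
  rw [dense_iff_closure_eq, Set.eq_univ_iff_forall]
  intro z
  exact specializes_iff_mem_closure.mp (specializes_of_flat_of_injective φ hinj hz₀ z)

/-- **Resolutions pull back along flat preimmersions through the generic point** (non-affine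
form of "resolutions localize"): for `X` integral, `ι : Z ⟶ X` flat and a preimmersion with
`genericPoint X ∈ range ι`, a weak resolution `π : X' ⟶ X` base-changes to the weak resolution
`X' ×_X Z ⟶ Z` — proper (base change), regular source (`X' ×_X Z ⟶ X'` is flat and surjective on
stalks), birational (an isomorphism over `ι⁻¹U`, dense with dense preimage because the points over
the generic points are generic, flat preimmersions being generalizing and injective).
[cite: EGAIV3, 8.10.5] -/
theorem stub_resolutionPullback :
    ∀ (X Z : Scheme.{0}) (ι : Z ⟶ X) [IsIntegral X] [Flat ι] [IsPreimmersion ι],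
      genericPoint X ∈ Set.range ι.base → Scheme.HasResolution X → Scheme.HasResolution Z := by
  intro X Z ι _ _ _ hgen h
  obtain ⟨z₀, hz₀⟩ := hgen
  obtain ⟨X', π, hπ⟩ := h
  haveI := hπ.isProper
  obtain ⟨U, hU, hU', hiso⟩ := hπ.isBirational
  haveI := hiso
  haveI : IrreducibleSpace X' := IsBirational.irreducibleSpace ⟨U, hU, hU', hiso⟩
  -- generic points: `π ξ_{X'} = ξ_X = ι z₀`, and `ξ_X ∈ U`
  have hπξ : π.base (genericPoint X') = genericPoint X :=
    apply_genericPoint_eq_of_isIso_morphismRestrict π U hU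
  have hηU : genericPoint X ∈ (U : Set X) := genericPoint_mem_of_isOpen U.2 hU.nonempty
  -- the point of the base change over `(ξ_{X'}, z₀)`
  obtain ⟨q₀, hq₁, hq₂⟩ := Scheme.Pullback.exists_preimage_pullback (f := π) (g := ι)
    (genericPoint X') z₀ (hπξ.trans hz₀.symm)
  refine ⟨pullback π ι, pullback.snd π ι, inferInstance,
    ⟨ι ⁻¹ᵁ U, ?_, ?_,
      Literature.AlgebraicGeometry.Morphisms.isIso_morphismRestrict_pullback_snd π ι U⟩,
    hπ.isRegular.of_flat_of_surjectiveOnStalks (pullback.fst π ι)⟩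
  · -- `ι⁻¹U ∋ z₀`, and `z₀` is a generic point of `Z`
    refine dense_of_mem_of_flat_of_injective ι ι.isEmbedding.injective hz₀ ?_
    change ι.base z₀ ∈ (U : Set X)
    rw [hz₀]
    exact hηU
  · -- the preimage of `ι⁻¹U` contains `q₀`, a generic point of the base change
    refine dense_of_mem_of_flat_of_injective (pullback.fst π ι)
      (pullback.fst π ι).isEmbedding.injective hq₁ ?_
    change ι.base ((pullback.snd π ι).base q₀) ∈ (U : Set X)
    rw [hq₂, hz₀]
    exact hηU

end Summit.ResolutionOfSingularities.ResolutionOfSingularities.Theorems.ProductDescent.Birth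

end
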